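import Mathlib
import HarnessLib
import HarnessLib.Audit
import Summits.QuantumFields.Statement
import Summits.QuantumFields.YangMills.Theses.UnitScaleTilt
import Summits.QuantumFields.YangMills.Theses.FibreConvexityTail
import Summits.QuantumFields.YangMills.Theorems.FibreConvexityTailHistoryTailOfTwoSided
import Literature.MathematicalPhysics.QuantumFieldTheory.Balaban1983to89.T3YM3TorusStatement
import Summits.QuantumFields.YangMills.Theses.MultiscaleHerbst


/-!
# Crux `HistoryTailL` (stmt-QuantumFields-19936) — LINE «multiscale-herbst», skeleton v4 (ideator seat ym-r3-idea-2 g5, lens «nearmiss»)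

v4 = the route's rev-1/rev-2 amendment after critic verdict #112 (prices 2–3): the line now rests on the WEAKEST-SUFFICIENT crux
`WindowHerbstCapL` (stmt-QuantumFields-28309; the Herbst entropy clause only on the Chernoff range `0 ≤ t ≤ p(g_(K−j))`), cut into the
two REGIME STUBS of the technique — the DEEP regime `stub_deepWindowHerbstCap` (2j+2 ≤ K: every fluctuating scale s ≤ j+1 lies below
K/2, bare nested-chart convexity — JOB B's PASS region, Φ(ε₀L^s) > 0) and the SHALLOW regime `stub_shallowWindowHerbstCap` (K < 2j+2:
fluctuation scales past K/2, where only the Ward-dressed coarse-grained stiffness ⟨Hess⟩ − Cov(∇_s S | finer) is positive) — joined by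
monotone closure (pure logic, `WindowHerbstCapL_of`), plus the support item `TwoSidedOfWindowHerbstCap` (stmt-QuantumFields-28310: Herbst on
[0, p] + Chernoff, provable now) as STUB 0; with the residual `TowerTailL` (stmt-QuantumFields-25568) as a HYPOTHESIS they give
`UnitScaleTilt.HistoryTailL` BY NAME through the landed glue `fibreConvexityTail_historyTailOfTwoSided_proof` (p609164).
The rev-0 strong crux `WindowHerbstL` (∀ t ≥ 0; now ASIDE on the route) implies the capped one by dropping the cap
(`windowHerbstCapL_of_windowHerbstL`, no sorry) — so the landed p643113 (`stub_twoSidedOfWindowHerbst`) stays usable context.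
WHAT IS FREE / WHAT IS CONTENT (critic #112): Ent(e^(tf)) ≤ (osc f)²t²/8·∫e^(tf) for any bounded f (Hoeffding); on the event
f ≤ 151L^(5/2)·p(g_(K−j+1)) deterministically, so σ_free ≈ 75L^(5/2)·p gives exp(−O(L^(−5))): no decay — the stubs' content is
σ = O(1) uniformly in (K, j, a).  INSTRUMENT BEFORE PROVERS: the dressed-stiffness row κ_eff(s)·4^s/β_K at 2j+2 = K, K = 3,4,5.
Sorries ONLY inside `stub_*`.  No summit, no rung (`YM3TorusSU2`), no mass gap is proved; `HistoryTailL` stays open behind the stubs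
and the residual.
-/

namespace Summit.QuantumFields.YangMills.Cruxes.HistoryTailL.MultiscaleHerbst

open MeasureTheory
open Summit.QuantumFields.YangMills.Theses.MultiscaleHerbst (WindowHerbstL WindowHerbstCapL TowerTailL TwoSidedOfWindowHerbstCap)

/-! ## §1 The registered stubs (the ONLY sorries) -/

/-- STUB 0 (S, = support item `TwoSidedOfWindowHerbstCap`, stmt-QuantumFields-28310): Herbst's argument ON [0, p] (φ(t) = t⁻¹·log(∫_W e^{tf}/Gibbs(W)) − σ²t/2
has φ′ ≤ 0 wherever the entropy bound holds, φ(0⁺) = E_W f ≤ p/4) gives ∫_W e^{tf} ≤ Gibbs(W)·exp(tp/4 + σ²t²/2) for t ≤ p; Markov at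
t = min(p, 3p/(4σ²)) on W ∩ {p ≤ f} ⊇ the two-sided event gives TwoSidedTailL with C = 1, A = 0, c = min(1/4, 9/(32σ²)).  Adapt the landed
p643113 (`Theorems/MultiscaleHerbstTwoSidedOfWindowHerbst.lean`, `herbst_mgf_le`) — in-tree `Literature.Probability.Moments.HerbstArgument`. -/
theorem stub_twoSidedOfWindowHerbstCap : TwoSidedOfWindowHerbstCap := by
  sorry

/-- STUB 1 (L; the BC5 first rung, plan-only): the CAPPED window Herbst bound in the DEEP HALF `2j+2 ≤ K` — all fluctuating scales s ≤ j+1 of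
the fibre over Ū^(j+2) lie below K/2, where the nested fluctuation chart is bare-convex on the window (JOB B: κ₀ = 4^(−s)β_K·Φ(ε₀L^s),
Φ > 0 for ε₀L^s ≲ 2): Bakry–Émery on SU(2)^E ∩ chart-convex window ⊇ W (BGL Prop 5.7.1 p.268 + Holley–Stroock), two-scale LSI across the
scales 0..j+1 (Otto–Reznikoff Thm 2 p.128 / GOVW Thm 3 p.307 with Brascamp–Lieb off-diagonal control), Herbst in the weighted carré du champ
Σ_s ρ_s⁻¹|∇_s f|² = O(1). -/
theorem stub_deepWindowHerbstCap : open Literature.MathematicalPhysics.QuantumFieldTheory.Balaban1983to89 Literature.MathematicalPhysics.QuantumFieldTheory.Balaban1983to89.T3ContinuumYM3Torus in ∀ (L : ℕ), ∃ bmin : ℝ, ∀ (b₀ p₀ : ℝ), bmin ≤ b₀ → 0 < b₀ → 2 < p₀ → ∃ γ₁ : ℝ, 0 < γ₁ ∧ γ₁ ≤ 1 ∧ ∀ (F : T3Family) (γ : ℝ), F.L = L → 0 < γ → γ ≤ γ₁ → ∃ σ : ℝ, 0 < σ ∧ ∀ (K j : ℕ), 1 ≤ j → j + 2 ≤ K →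 2 * j + 2 ≤ K → ∀ (a : Plaq (F.P K) j), ∃ W, MeasurableSet W ∧ ({U | ∀ i, i < j → PlaqSmall (T3UnitScaleTilt.θBal F.L γ b₀ p₀ (K - i)) (Averaging.iter (fun i' => BlockAveraging.blockAvg (P := F.P K) (j := i') T3UnitLawDensityEML.ℰp) i U)} ∩ {U | PlaqSmall (T3UnitScaleTilt.θBal F.L γ b₀ p₀ (K - (j + 2))) (Averaging.iter (fun i' => BlockAveraging.blockAvg (P := F.P K) (j := i') T3UnitLawDensityEML.ℰp) (j + 2) U)}) ⊆ W ∧ (∫ U in W, GaugeGroup.dist1 (GaugeField.plaqHol (Averaging.iter (fun i' => BlockAveraging.blockAvg (P := F.P K) (j := i') T3UnitLawDensityEML.ℰp) j U) a) / Real.sqrt (γ * ((F.L : ℝ)⁻¹) ^ (K - j)) ∂(T3UnitScaleTilt.gibbsK F T3UnitLawDensityEML.ℰp γ K) ≤ B10.pFun b₀ p₀ (Real.sqrt (γ * ((F.L : ℝ)⁻¹) ^ (K - j))) / 4 * (T3UnitScaleTilt.gibbsK F T3UnitLawDensityEML.ℰp γ K).real W) ∧ ∀ (t : ℝ), 0 ≤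 t → t ≤ B10.pFun b₀ p₀ (Real.sqrt (γ * ((F.L : ℝ)⁻¹) ^ (K - j))) → (∫ U in W, Real.exp (t * (GaugeGroup.dist1 (GaugeField.plaqHol (Averaging.iter (fun i' => BlockAveraging.blockAvg (P := F.P K) (j := i') T3UnitLawDensityEML.ℰp) j U) a) / Real.sqrt (γ * ((F.L : ℝ)⁻¹) ^ (K - j)))) * (t * (GaugeGroup.dist1 (GaugeField.plaqHol (Averaging.iter (fun i' => BlockAveraging.blockAvg (P := F.P K) (j := i') T3UnitLawDensityEML.ℰp) j U) a) / Real.sqrt (γ * ((F.L : ℝ)⁻¹) ^ (K - j)))) ∂(T3UnitScaleTilt.gibbsK F T3UnitLawDensityEML.ℰp γ K)) - (∫ U in W, Real.exp (t * (GaugeGroup.dist1 (GaugeField.plaqHol (Averaging.iter (fun i' => BlockAveraging.blockAvg (P := F.P K) (j := i') T3UnitLawDensityEML.ℰp) j U) a) / Real.sqrt (γ * ((F.L : ℝ)⁻¹) ^ (K - j)))) ∂(T3UnitScaleTilt.gibbsK F T3UnitLawDensityEML.ℰp γ K)) * Real.log ((∫ U in W, Real.exp (t * (GaugeGroup.dist1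 (GaugeField.plaqHol (Averaging.iter (fun i' => BlockAveraging.blockAvg (P := F.P K) (j := i') T3UnitLawDensityEML.ℰp) j U) a) / Real.sqrt (γ * ((F.L : ℝ)⁻¹) ^ (K - j)))) ∂(T3UnitScaleTilt.gibbsK F T3UnitLawDensityEML.ℰp γ K)) / (T3UnitScaleTilt.gibbsK F T3UnitLawDensityEML.ℰp γ K).real W) ≤ σ ^ 2 * t ^ 2 / 2 * ∫ U in W, Real.exp (t * (GaugeGroup.dist1 (GaugeField.plaqHol (Averaging.iter (fun i' => BlockAveraging.blockAvg (P := F.P K) (j := i') T3UnitLawDensityEML.ℰp) j U) a) / Real.sqrt (γ * ((F.L : ℝ)⁻¹) ^ (K - j)))) ∂(T3UnitScaleTilt.gibbsK F T3UnitLawDensityEML.ℰp γ K) := by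
  sorry

/-- STUB 2 (XL, load-bearing): the CAPPED window Herbst bound in the SHALLOW HALF `K < 2j+2` — fluctuating scales s > K/2 are destabilised by
the UV self-energy of the finer modes (JOB B collapse law), so the coarse-grained stiffness ⟨Hess_ss S⟩_W − Cov_W(∇_s S | scales < s) ≥ ½ρ_s
(Ward-protected: the k⁰ pieces of the one- and two-loop self-energy cancel by the lattice Ward identity of the covariant average; Bałaban's
positivity of the effective quadratic form, [Balaban1985UV3] (70)–(71) p.273) is the load-bearing input of the multiscale Bakry–Émery /
two-scale LSI (nearest print: Bauerschmidt–Bodineau arXiv:1907.12308, Bauerschmidt–Dagallier arXiv:2202.02295 Thm 1.1 — scalar fields;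
the SU(2)^E-fibre transplant is not in print).  KILL ROW: κ_eff(s)·4^s/β_K at s = 2j+2 = K, K = 3,4,5. -/
theorem stub_shallowWindowHerbstCap : open Literature.MathematicalPhysics.QuantumFieldTheory.Balaban1983to89 Literature.MathematicalPhysics.QuantumFieldTheory.Balaban1983to89.T3ContinuumYM3Torus in ∀ (L : ℕ), ∃ bmin : ℝ, ∀ (b₀ p₀ : ℝ), bmin ≤ b₀ → 0 < b₀ → 2 < p₀ → ∃ γ₁ : ℝ, 0 < γ₁ ∧ γ₁ ≤ 1 ∧ ∀ (F : T3Family) (γ : ℝ), F.L = L → 0 < γ → γ ≤ γ₁ → ∃ σ : ℝ, 0 < σ ∧ ∀ (K j : ℕ), 1 ≤ j → j + 2 ≤ K → K < 2 * j + 2 → ∀ (a : Plaq (F.P K) j), ∃ W, MeasurableSet W ∧ ({U | ∀ i, i < j → PlaqSmall (T3UnitScaleTilt.θBal F.L γ b₀ p₀ (K - i)) (Averaging.iter (fun i' => BlockAveraging.blockAvg (P := F.P K) (j := i') T3UnitLawDensityEML.ℰp) i U)} ∩ {U | PlaqSmall (T3UnitScaleTilt.θBal F.L γ b₀ p₀ (K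 - (j + 2))) (Averaging.iter (fun i' => BlockAveraging.blockAvg (P := F.P K) (j := i') T3UnitLawDensityEML.ℰp) (j + 2) U)}) ⊆ W ∧ (∫ U in W, GaugeGroup.dist1 (GaugeField.plaqHol (Averaging.iter (fun i' => BlockAveraging.blockAvg (P := F.P K) (j := i') T3UnitLawDensityEML.ℰp) j U) a) / Real.sqrt (γ * ((F.L : ℝ)⁻¹) ^ (K - j)) ∂(T3UnitScaleTilt.gibbsK F T3UnitLawDensityEML.ℰp γ K) ≤ B10.pFun b₀ p₀ (Real.sqrt (γ * ((F.L : ℝ)⁻¹) ^ (K - j))) / 4 * (T3UnitScaleTilt.gibbsK F T3UnitLawDensityEML.ℰp γ K).real W) ∧ ∀ (t : ℝ), 0 ≤ t → t ≤ B10.pFun b₀ p₀ (Real.sqrt (γ * ((F.L : ℝ)⁻¹) ^ (K - j))) → (∫ U in W, Real.exp (t * (GaugeGroup.dist1 (GaugeField.plaqHol (Averaging.iter (fun i' => BlockAveraging.blockAvg (P := F.P K) (j := i') T3UnitLawDensityEML.ℰp) j U) a) / Real.sqrt (γ * ((F.L : ℝ)⁻¹) ^ (K - j)))) * (t * (GaugeGroup.dist1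 (GaugeField.plaqHol (Averaging.iter (fun i' => BlockAveraging.blockAvg (P := F.P K) (j := i') T3UnitLawDensityEML.ℰp) j U) a) / Real.sqrt (γ * ((F.L : ℝ)⁻¹) ^ (K - j)))) ∂(T3UnitScaleTilt.gibbsK F T3UnitLawDensityEML.ℰp γ K)) - (∫ U in W, Real.exp (t * (GaugeGroup.dist1 (GaugeField.plaqHol (Averaging.iter (fun i' => BlockAveraging.blockAvg (P := F.P K) (j := i') T3UnitLawDensityEML.ℰp) j U) a) / Real.sqrt (γ * ((F.L : ℝ)⁻¹) ^ (K - j)))) ∂(T3UnitScaleTilt.gibbsK F T3UnitLawDensityEML.ℰp γ K)) * Real.log ((∫ U in W, Real.exp (t * (GaugeGroup.dist1 (GaugeField.plaqHol (Averaging.iter (fun i' => BlockAveraging.blockAvg (P := F.P K) (j := i') T3UnitLawDensityEML.ℰp) j U) a) / Real.sqrt (γ * ((F.L : ℝ)⁻¹) ^ (K - j)))) ∂(T3UnitScaleTilt.gibbsK F T3UnitLawDensityEML.ℰp γ K)) / (T3UnitScaleTilt.gibbsK F T3UnitLawDensityEML.ℰp γ K).real W) ≤ σ ^ 2 * t ^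 2 / 2 * ∫ U in W, Real.exp (t * (GaugeGroup.dist1 (GaugeField.plaqHol (Averaging.iter (fun i' => BlockAveraging.blockAvg (P := F.P K) (j := i') T3UnitLawDensityEML.ℰp) j U) a) / Real.sqrt (γ * ((F.L : ℝ)⁻¹) ^ (K - j)))) ∂(T3UnitScaleTilt.gibbsK F T3UnitLawDensityEML.ℰp γ K) := by
  sorry

/-! ## §2 The crux of the route and the crux of `UnitScaleTilt` BY NAME — no sorry below this line -/

/-- COMPOSITION (kernel-checked, no sorry): the two regime stubs give the route crux `WindowHerbstCapL` BY NAME (monotone closure: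
bmin ↦ max, γ₁ ↦ min, σ ↦ max; the entropy clause is monotone in σ because ∫_W e^{tf} ≥ 0; the cap `t ≤ p` is σ-free). -/
theorem WindowHerbstCapL_of (h₁ : open Literature.MathematicalPhysics.QuantumFieldTheory.Balaban1983to89 Literature.MathematicalPhysics.QuantumFieldTheory.Balaban1983to89.T3ContinuumYM3Torus in ∀ (L : ℕ), ∃ bmin : ℝ, ∀ (b₀ p₀ : ℝ), bmin ≤ b₀ → 0 < b₀ → 2 < p₀ → ∃ γ₁ : ℝ, 0 < γ₁ ∧ γ₁ ≤ 1 ∧ ∀ (F : T3Family) (γ : ℝ), F.L = L → 0 < γ → γ ≤ γ₁ → ∃ σ : ℝ, 0 < σ ∧ ∀ (K j : ℕ), 1 ≤ j → j + 2 ≤ K → 2 * j + 2 ≤ K → ∀ (a : Plaq (F.P K) j), ∃ W, MeasurableSet W ∧ ({U | ∀ i, i < j → PlaqSmall (T3UnitScaleTilt.θBal F.L γ b₀ p₀ (K - i)) (Averaging.iter (fun i' => BlockAveraging.blockAvg (P := F.P K) (j := i') T3UnitLawDensityEML.ℰp) i U)} ∩ {U | PlaqSmall (T3UnitScaleTilt.θBal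 F.L γ b₀ p₀ (K - (j + 2))) (Averaging.iter (fun i' => BlockAveraging.blockAvg (P := F.P K) (j := i') T3UnitLawDensityEML.ℰp) (j + 2) U)}) ⊆ W ∧ (∫ U in W, GaugeGroup.dist1 (GaugeField.plaqHol (Averaging.iter (fun i' => BlockAveraging.blockAvg (P := F.P K) (j := i') T3UnitLawDensityEML.ℰp) j U) a) / Real.sqrt (γ * ((F.L : ℝ)⁻¹) ^ (K - j)) ∂(T3UnitScaleTilt.gibbsK F T3UnitLawDensityEML.ℰp γ K) ≤ B10.pFun b₀ p₀ (Real.sqrt (γ * ((F.L : ℝ)⁻¹) ^ (K - j))) / 4 * (T3UnitScaleTilt.gibbsK F T3UnitLawDensityEML.ℰp γ K).real W) ∧ ∀ (t : ℝ), 0 ≤ t → t ≤ B10.pFun b₀ p₀ (Real.sqrt (γ * ((F.L : ℝ)⁻¹) ^ (K - j))) → (∫ U in W, Real.exp (t * (GaugeGroup.dist1 (GaugeField.plaqHol (Averaging.iter (fun i' => BlockAveraging.blockAvg (P := F.P K) (j := i') T3UnitLawDensityEML.ℰp) j U) a) / Real.sqrt (γ * ((F.L : ℝ)⁻¹) ^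 (K - j)))) * (t * (GaugeGroup.dist1 (GaugeField.plaqHol (Averaging.iter (fun i' => BlockAveraging.blockAvg (P := F.P K) (j := i') T3UnitLawDensityEML.ℰp) j U) a) / Real.sqrt (γ * ((F.L : ℝ)⁻¹) ^ (K - j)))) ∂(T3UnitScaleTilt.gibbsK F T3UnitLawDensityEML.ℰp γ K)) - (∫ U in W, Real.exp (t * (GaugeGroup.dist1 (GaugeField.plaqHol (Averaging.iter (fun i' => BlockAveraging.blockAvg (P := F.P K) (j := i') T3UnitLawDensityEML.ℰp) j U) a) / Real.sqrt (γ * ((F.L : ℝ)⁻¹) ^ (K - j)))) ∂(T3UnitScaleTilt.gibbsK F T3UnitLawDensityEML.ℰp γ K)) * Real.log ((∫ U in W, Real.exp (t * (GaugeGroup.dist1 (GaugeField.plaqHol (Averaging.iter (fun i' => BlockAveraging.blockAvg (P := F.P K) (j := i') T3UnitLawDensityEML.ℰp) j U) a) / Real.sqrt (γ * ((F.L : ℝ)⁻¹) ^ (K - j)))) ∂(T3UnitScaleTilt.gibbsK F T3UnitLawDensityEML.ℰp γ K)) / (T3UnitScaleTilt.gibbsK F T3UnitLawDensityEML.ℰp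 γ K).real W) ≤ σ ^ 2 * t ^ 2 / 2 * ∫ U in W, Real.exp (t * (GaugeGroup.dist1 (GaugeField.plaqHol (Averaging.iter (fun i' => BlockAveraging.blockAvg (P := F.P K) (j := i') T3UnitLawDensityEML.ℰp) j U) a) / Real.sqrt (γ * ((F.L : ℝ)⁻¹) ^ (K - j)))) ∂(T3UnitScaleTilt.gibbsK F T3UnitLawDensityEML.ℰp γ K)) (h₂ : open Literature.MathematicalPhysics.QuantumFieldTheory.Balaban1983to89 Literature.MathematicalPhysics.QuantumFieldTheory.Balaban1983to89.T3ContinuumYM3Torus in ∀ (L : ℕ), ∃ bmin : ℝ, ∀ (b₀ p₀ : ℝ), bmin ≤ b₀ → 0 < b₀ → 2 < p₀ → ∃ γ₁ : ℝ, 0 < γ₁ ∧ γ₁ ≤ 1 ∧ ∀ (F : T3Family) (γ : ℝ), F.L = L → 0 < γ → γ ≤ γ₁ → ∃ σ : ℝ, 0 < σ ∧ ∀ (K j : ℕ), 1 ≤ j → j + 2 ≤ K → K < 2 * j + 2 → ∀ (a : Plaq (F.P K) j), ∃ W, MeasurableSet W ∧ ({U | ∀ i, i < j → PlaqSmall (T3UnitScaleTilt.θBal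 F.L γ b₀ p₀ (K - i)) (Averaging.iter (fun i' => BlockAveraging.blockAvg (P := F.P K) (j := i') T3UnitLawDensityEML.ℰp) i U)} ∩ {U | PlaqSmall (T3UnitScaleTilt.θBal F.L γ b₀ p₀ (K - (j + 2))) (Averaging.iter (fun i' => BlockAveraging.blockAvg (P := F.P K) (j := i') T3UnitLawDensityEML.ℰp) (j + 2) U)}) ⊆ W ∧ (∫ U in W, GaugeGroup.dist1 (GaugeField.plaqHol (Averaging.iter (fun i' => BlockAveraging.blockAvg (P := F.P K) (j := i') T3UnitLawDensityEML.ℰp) j U) a) / Real.sqrt (γ * ((F.L : ℝ)⁻¹) ^ (K - j)) ∂(T3UnitScaleTilt.gibbsK F T3UnitLawDensityEML.ℰp γ K) ≤ B10.pFun b₀ p₀ (Real.sqrt (γ * ((F.L : ℝ)⁻¹) ^ (K - j))) / 4 * (T3UnitScaleTilt.gibbsK F T3UnitLawDensityEML.ℰp γ K).real W) ∧ ∀ (t : ℝ), 0 ≤ t → t ≤ B10.pFun b₀ p₀ (Real.sqrt (γ * ((F.L : ℝ)⁻¹) ^ (K - j))) → (∫ U in W, Real.exp (t * (GaugeGroup.dist1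 (GaugeField.plaqHol (Averaging.iter (fun i' => BlockAveraging.blockAvg (P := F.P K) (j := i') T3UnitLawDensityEML.ℰp) j U) a) / Real.sqrt (γ * ((F.L : ℝ)⁻¹) ^ (K - j)))) * (t * (GaugeGroup.dist1 (GaugeField.plaqHol (Averaging.iter (fun i' => BlockAveraging.blockAvg (P := F.P K) (j := i') T3UnitLawDensityEML.ℰp) j U) a) / Real.sqrt (γ * ((F.L : ℝ)⁻¹) ^ (K - j)))) ∂(T3UnitScaleTilt.gibbsK F T3UnitLawDensityEML.ℰp γ K)) - (∫ U in W, Real.exp (t * (GaugeGroup.dist1 (GaugeField.plaqHol (Averaging.iter (fun i' => BlockAveraging.blockAvg (P := F.P K) (j := i') T3UnitLawDensityEML.ℰp) j U) a) / Real.sqrt (γ * ((F.L : ℝ)⁻¹) ^ (K - j)))) ∂(T3UnitScaleTilt.gibbsK F T3UnitLawDensityEML.ℰp γ K)) * Real.log ((∫ U in W, Real.exp (t * (GaugeGroup.dist1 (GaugeField.plaqHol (Averaging.iter (fun i' => BlockAveraging.blockAvg (P := F.P K) (j := i') T3UnitLawDensityEML.ℰp) j U) a) / Real.sqrt (γ *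 ((F.L : ℝ)⁻¹) ^ (K - j)))) ∂(T3UnitScaleTilt.gibbsK F T3UnitLawDensityEML.ℰp γ K)) / (T3UnitScaleTilt.gibbsK F T3UnitLawDensityEML.ℰp γ K).real W) ≤ σ ^ 2 * t ^ 2 / 2 * ∫ U in W, Real.exp (t * (GaugeGroup.dist1 (GaugeField.plaqHol (Averaging.iter (fun i' => BlockAveraging.blockAvg (P := F.P K) (j := i') T3UnitLawDensityEML.ℰp) j U) a) / Real.sqrt (γ * ((F.L : ℝ)⁻¹) ^ (K - j)))) ∂(T3UnitScaleTilt.gibbsK F T3UnitLawDensityEML.ℰp γ K)) : WindowHerbstCapL := by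
  intro L
  obtain ⟨b₁, H₁⟩ := h₁ L
  obtain ⟨b₂, H₂⟩ := h₂ L
  refine ⟨max b₁ b₂, fun b₀ p₀ hb hb₀ hp₀ => ?_⟩
  obtain ⟨γ₁, hγ₁, hγ₁1, G₁⟩ := H₁ b₀ p₀ ((le_max_left _ _).trans hb) hb₀ hp₀
  obtain ⟨γ₂, hγ₂, -, G₂⟩ := H₂ b₀ p₀ ((le_max_right _ _).trans hb) hb₀ hp₀
  refine ⟨min γ₁ γ₂, lt_min hγ₁ hγ₂, (min_le_left _ _).trans hγ₁1, fun F γ hF hγ hγle => ?_⟩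
  obtain ⟨σ₁, hσ₁, S₁⟩ := G₁ F γ hF hγ (hγle.trans (min_le_left _ _))
  obtain ⟨σ₂, hσ₂, S₂⟩ := G₂ F γ hF hγ (hγle.trans (min_le_right _ _))
  have hmono : ∀ (σ' t : ℝ), 0 < σ' → σ' ≤ max σ₁ σ₂ → σ' ^ 2 * t ^ 2 / 2 ≤ max σ₁ σ₂ ^ 2 * t ^ 2 / 2 := by
    intro σ' t hσ' hle
    have h1 : σ' ^ 2 ≤ max σ₁ σ₂ ^ 2 := by nlinarith [mul_le_mul hle hle hσ'.le (hσ'.le.trans hle)]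
    have h2 : 0 ≤ t ^ 2 / 2 := by positivity
    calc σ' ^ 2 * t ^ 2 / 2 = σ' ^ 2 * (t ^ 2 / 2) := by ring
      _ ≤ max σ₁ σ₂ ^ 2 * (t ^ 2 / 2) := mul_le_mul_of_nonneg_right h1 h2
      _ = max σ₁ σ₂ ^ 2 * t ^ 2 / 2 := by ring
  refine ⟨max σ₁ σ₂, lt_max_of_lt_left hσ₁, fun K j hj hjK a => ?_⟩
  by_cases hreg : 2 * j + 2 ≤ K
  · obtain ⟨W, hWm, hWsub, hcen, hent⟩ := S₁ K j hj hjK hreg a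
    exact ⟨W, hWm, hWsub, hcen, fun t ht htp => (hent t ht htp).trans
      (mul_le_mul_of_nonneg_right (hmono σ₁ t hσ₁ (le_max_left _ _)) (integral_nonneg fun _ => (Real.exp_pos _).le))⟩
  · obtain ⟨W, hWm, hWsub, hcen, hent⟩ := S₂ K j hj hjK (not_le.mp hreg) a
    exact ⟨W, hWm, hWsub, hcen, fun t ht htp => (hent t ht htp).trans
      (mul_le_mul_of_nonneg_right (hmono σ₂ t hσ₂ (le_max_right _ _)) (integral_nonneg fun _ => (Real.exp_pos _).le))⟩

/-- CONTEXT (no sorry): the route's rev-0 strong crux `WindowHerbstL` (∀ t ≥ 0; now ASIDE) implies the capped crux by dropping the cap —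
so the landed p643113 / any future proof of the strong form still feeds this line. -/
theorem windowHerbstCapL_of_windowHerbstL (h : WindowHerbstL) : WindowHerbstCapL := by
  intro L
  obtain ⟨bmin, hb⟩ := h L
  refine ⟨bmin, fun b₀ p₀ h1 h2 h3 => ?_⟩
  obtain ⟨γ₁, hγ₁, hγ₁1, hF⟩ := hb b₀ p₀ h1 h2 h3
  refine ⟨γ₁, hγ₁, hγ₁1, fun F γ hL hγ hγle => ?_⟩
  obtain ⟨σ, hσ, hK⟩ := hF F γ hL hγ hγle
  refine ⟨σ, hσ, fun K j hj hjK a => ?_⟩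
  obtain ⟨W, hWm, hWsub, hcen, hent⟩ := hK K j hj hjK a
  exact ⟨W, hWm, hWsub, hcen, fun t ht _ => hent t ht⟩

/-- THE ORGAN BY NAME (kernel-checked, no sorry): the three registered stubs and the RESIDUAL `TowerTailL` (the shared open item
stmt-QuantumFields-25568, a hypothesis here exactly as in the route's `closes`) give `UnitScaleTilt.HistoryTailL` through the landed
glue of route FibreConvexityTail. -/
theorem HistoryTailL_of (hT : Summit.QuantumFields.YangMills.Theses.FibreConvexityTail.TowerTailL) :
    Summit.QuantumFields.YangMills.Theses.UnitScaleTilt.HistoryTailL :=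
  Summit.QuantumFields.YangMills.Theorems.fibreConvexityTail_historyTailOfTwoSided_proof
    (stub_twoSidedOfWindowHerbstCap (WindowHerbstCapL_of stub_deepWindowHerbstCap stub_shallowWindowHerbstCap)) hT

end Summit.QuantumFields.YangMills.Cruxes.HistoryTailL.MultiscaleHerbst
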